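import Literature.NumberTheory.LFunctions.FreitasLiHalfPlanesProofs
import Literature.Analysis.SpecialFunctions.EulerMascheroniSharpBounds
import HarnessLib

/-!
# Freitas 2006 — proofs, part 2: Theorem 5.6 (the expansion of `F(x,τ)` with `ℓ_k(τ)`)

Companion to `FreitasLiHalfPlanesProofs.lean` (which reached the proposal size limit): the discharge of
`Freitas2006_thm_5_6` of `FreitasLiHalfPlanes.lean`.  RH-FREE.

Proof as printed (P. Freitas, *A Li-type criterion for zero-free half-planes of Riemann's zeta
function*, arXiv:math/0507368, p0011:L64–84): `(ρ/(ρ−τ))ˣ = (1 + τ/(ρ−τ))ˣ = Σ_k C(x,k) (τ/(ρ−τ))ᵏ`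
(the binomial series, `|τ/(ρ−τ)| < 1`, Mathlib `Complex.one_add_cpow_hasFPowerSeriesOnBall_zero`),
and the power sums at `τ`, `Σ_ρ m(ρ) Re (ρ−τ)^{−(k+1)} = −ℓ_k(τ)` — the partial fractions of `ξ'/ξ`
differentiated `k` times at `s = τ` (`IsHadamardSeq.hasSum_iteratedDeriv_term_at`) transferred to
the zeros with multiplicity (`IsHadamardSeq.finsum_liZeroBox_eq_sum`); the double series over
zeros × ℕ converges absolutely (`|τ| ≤ s|ρ−τ|` with `s < 1`; the row `k = 1` through
`|Re (ρ−τ)^{−1}| ≤ (1+|τ|)/|ρ−τ|²`), so it may be summed in either order (`HasSum.prod_fiberwise`).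

## Contents

* `hasSum_one_add_cpow'` — the binomial series `(1+t)ˣ = Σ_n [Π_{j<n}(x−j)/n!] tⁿ`, `‖t‖ < 1`.
* `hasSum_zeroOrder_mul_re_inv_sub_pow` — `Σ_ρ m(ρ) Re (ρ−τ)^{−(j+1)} = −ℓ_j(τ)` (absolutely).
* `Freitas2006_thm_5_6_holds`.
* `freitasEllCoeff_zero_zero_neg` (`ℓ₀ = log(2√π) − 1 − γ/2 < 0`), `abs_freitasEllCoeff_zero_le`
  (`|ℓ_k| ≤ 14^{1−k} Σ_ρ m(ρ)/|ρ|²`) and `Freitas2006_thm_5_5_holds` — Theorem 5.5 (`F < 0` on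
  `{x > x₀, 0 < τ < τ₀/x}`), from Theorem 5.1: `F(x,τ) ≤ x[ℓ₀ + Mτ(4x+2)]`.

## References

* P. Freitas, J. London Math. Soc. (2) 73 (2006) 399–414, Thm 5.6. [Freitas2006LiHalfPlanes]
-/

noncomputable section

open Complex Filter Set Metric
open scoped Nat Topology ComplexOrder ComplexConjugate

namespace Literature.NumberTheory.LFunctions

open ZetaZeros

/-! ## Local copies of private helpers of `FreitasLiHalfPlanesProofs.lean` -/

/-- A non-trivial zero is not a real number `τ` (`ξ(τ) > 0`). [folklore] -/
private theorem zero_ne_ofReal (ρ : ZetaZeros.riemannZetaNontrivialZeros) (τ : ℝ) :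
    (ρ : ℂ) ≠ (τ : ℂ) := by
  intro e
  have hξ : riemannXi (ρ : ℂ) = 0 := (riemannXi_eq_zero_iff_holds _).2
    ⟨riemannZetaNontrivialZeros.zeta_eq_zero ρ.2, riemannZetaNontrivialZeros.re_pos ρ.2,
      riemannZetaNontrivialZeros.re_lt_one ρ.2⟩
  rw [e] at hξ
  exact (riemannXi_ofReal_pos τ).ne' hξ

/-- A non-trivial zero is not `0`. [folklore] -/
private theorem zero_ne_zero' (ρ : ZetaZeros.riemannZetaNontrivialZeros) : (ρ : ℂ) ≠ 0 := by
  intro e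
  have := riemannZetaNontrivialZeros.re_pos ρ.2
  rw [e] at this; simp at this

/-- Summability over the zeros from a bound `≤ C · m(ρ)/|ρ|²` off a finite set (here: off the zeros
with `|Im ρ| ≤ R`, `R ≥ 1`), via `Σ m(ρ)/(1+γ²) < ∞`. [folklore] -/
private theorem summable_zeros_of_le {fz : ZetaZeros.riemannZetaNontrivialZeros → ℝ} {C R : ℝ}
    (hR : 1 ≤ R) (h0 : ∀ ρ, 0 ≤ fz ρ)
    (hle : ∀ ρ : ZetaZeros.riemannZetaNontrivialZeros, R ≤ ‖(ρ : ℂ)‖ →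
      fz ρ ≤ C * ((riemannZetaZeroOrder (ρ : ℂ) : ℝ) / ‖(ρ : ℂ)‖ ^ 2)) :
    Summable fz := by
  classical
  set S : Finset ZetaZeros.riemannZetaNontrivialZeros := weilZeroFinset R with hS
  set ψ : ZetaZeros.riemannZetaNontrivialZeros → ℝ := fun ρ ↦ if ρ ∈ S then fz ρ else 0 with hψ
  have hψs : Summable ψ := by
    refine summable_of_hasFiniteSupport (S.finite_toSet.subset fun ρ hρ ↦ ?_)
    by_contra h
    rw [Finset.mem_coe] at h
    exact hρ (by simp [hψ, h])
  have hW := ZetaZeroSum.summable_zeroOrder_div_one_add_sq.mul_left (2 * |C|)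
  refine Summable.of_nonneg_of_le h0 (fun ρ ↦ ?_) (hψs.add hW)
  by_cases hρ : ρ ∈ S
  · simp only [hψ, hρ, if_true]
    have : 0 ≤ 2 * |C| * ((riemannZetaZeroOrder (ρ : ℂ) : ℝ) / (1 + ((ρ : ℂ)).im ^ 2)) :=
      mul_nonneg (by positivity) (div_nonneg (ZetaZeroSum.zeroOrder_nonneg ρ) (by positivity))
    linarith
  · simp only [hψ, hρ, if_false, zero_add]
    have hfar : R ≤ ‖(ρ : ℂ)‖ := by
      rw [hS, mem_weilZeroFinset, not_le] at hρ
      exact hρ.le.trans (Complex.abs_im_le_norm _)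
    have hm : (0 : ℝ) ≤ riemannZetaZeroOrder (ρ : ℂ) := ZetaZeroSum.zeroOrder_nonneg ρ
    have hρ1 : 1 ≤ ‖(ρ : ℂ)‖ := hR.trans hfar
    have hcmp : (riemannZetaZeroOrder (ρ : ℂ) : ℝ) / ‖(ρ : ℂ)‖ ^ 2 ≤
        2 * ((riemannZetaZeroOrder (ρ : ℂ) : ℝ) / (1 + ((ρ : ℂ)).im ^ 2)) := by
      rw [div_le_iff₀ (by positivity)]
      have him : ((ρ : ℂ)).im ^ 2 ≤ ‖(ρ : ℂ)‖ ^ 2 := by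
        rw [← sq_abs]; exact pow_le_pow_left₀ (abs_nonneg _) (Complex.abs_im_le_norm _) 2
      have : 1 + ((ρ : ℂ)).im ^ 2 ≤ 2 * ‖(ρ : ℂ)‖ ^ 2 := by nlinarith
      calc (riemannZetaZeroOrder (ρ : ℂ) : ℝ)
          = (riemannZetaZeroOrder (ρ : ℂ) : ℝ) / (1 + ((ρ : ℂ)).im ^ 2) * (1 + ((ρ : ℂ)).im ^ 2) := by
            field_simp
        _ ≤ (riemannZetaZeroOrder (ρ : ℂ) : ℝ) / (1 + ((ρ : ℂ)).im ^ 2) * (2 * ‖(ρ : ℂ)‖ ^ 2) :=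
            mul_le_mul_of_nonneg_left this (div_nonneg hm (by positivity))
        _ = 2 * ((riemannZetaZeroOrder (ρ : ℂ) : ℝ) / (1 + ((ρ : ℂ)).im ^ 2)) * ‖(ρ : ℂ)‖ ^ 2 := by
            ring
    calc fz ρ ≤ C * ((riemannZetaZeroOrder (ρ : ℂ) : ℝ) / ‖(ρ : ℂ)‖ ^ 2) := hle ρ hfar
      _ ≤ |C| * ((riemannZetaZeroOrder (ρ : ℂ) : ℝ) / ‖(ρ : ℂ)‖ ^ 2) :=
          mul_le_mul_of_nonneg_right (le_abs_self C) (div_nonneg hm (by positivity))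
      _ ≤ |C| * (2 * ((riemannZetaZeroOrder (ρ : ℂ) : ℝ) / (1 + ((ρ : ℂ)).im ^ 2))) :=
          mul_le_mul_of_nonneg_left hcmp (abs_nonneg C)
      _ = 2 * |C| * ((riemannZetaZeroOrder (ρ : ℂ) : ℝ) / (1 + ((ρ : ℂ)).im ^ 2)) := by ring

namespace IsHadamardSeq

variable {b : ℕ → ℂ}

/-- **The derivatives of one pair of terms at a zero-free point `c`**: for `bₖ ≠ 0`, near `c` the
`k`-th term is `1/(s−ρₖ) + 1/(s−(1−ρₖ))`, so its `j`-th derivative at `c` is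
`(−1)ʲ j! [(c−ρₖ)^{−(j+1)} + (c−(1−ρₖ))^{−(j+1)}]`. [folklore] -/
private theorem iteratedDeriv_term_at (h : IsHadamardSeq 0 b) {k : ℕ} (hk : b k ≠ 0) {c : ℂ}
    (hc : riemannXi c ≠ 0) (j : ℕ) :
    iteratedDeriv j (fun s ↦ -(4 * b k * (2 * s - 1)) / (1 - b k * (2 * s - 1) ^ 2)) c =
      (-1) ^ j * j ! * (((c - xiZero b k)⁻¹) ^ (j + 1) + ((c - (1 - xiZero b k))⁻¹) ^ (j + 1)) := by
  set ρ := xiZero b k with hρ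
  have hρ0 : riemannXi ρ = 0 := h.riemannXi_xiZero hk
  have hρ1 : riemannXi (1 - ρ) = 0 := h.riemannXi_one_sub_xiZero hk
  have hev : ∀ᶠ s in 𝓝 c, riemannXi s ≠ 0 :=
    differentiable_riemannXi.continuous.continuousAt.eventually_ne hc
  have hfe : (fun s ↦ -(4 * b k * (2 * s - 1)) / (1 - b k * (2 * s - 1) ^ 2)) =ᶠ[𝓝 c]
      fun s ↦ (1 * s - ρ)⁻¹ + (1 * s - (1 - ρ))⁻¹ := by
    filter_upwards [hev] with s hs
    have hs1 : s ≠ ρ := fun e ↦ hs (by rw [e]; exact hρ0)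
    have hs2 : s ≠ 1 - ρ := fun e ↦ hs (by rw [e]; exact hρ1)
    rw [term_eq_inv_add_inv b hk hs1 hs2]
    simp only [one_div, one_mul]
    rfl
  rw [hfe.iteratedDeriv_eq]
  have hne1 : c - ρ ≠ 0 := fun e ↦ hc (by rw [sub_eq_zero.1 e]; exact hρ0)
  have hne2 : c - (1 - ρ) ≠ 0 := fun e ↦ hc (by rw [sub_eq_zero.1 e]; exact hρ1)
  have hc1 : ContDiffAt ℂ j (fun s : ℂ ↦ (1 * s - ρ)⁻¹) c := by
    refine ContDiffAt.inv (by fun_prop) (by simpa using hne1)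
  have hc2 : ContDiffAt ℂ j (fun s : ℂ ↦ (1 * s - (1 - ρ))⁻¹) c := by
    refine ContDiffAt.inv (by fun_prop) (by simpa using hne2)
  rw [iteratedDeriv_fun_add hc1 hc2, iteratedDeriv_eq_iterate, iteratedDeriv_eq_iterate,
    iter_deriv_inv_linear_sub j 1 ρ, iter_deriv_inv_linear_sub j 1 (1 - ρ)]
  simp only [one_pow, mul_one, one_mul]
  have ez : ∀ a : ℂ, a ^ (-1 - j : ℤ) = (a⁻¹) ^ (j + 1) := by
    intro a
    rw [show (-1 - j : ℤ) = -((j + 1 : ℕ) : ℤ) by push_cast; ring, zpow_neg, zpow_natCast, inv_pow]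
  rw [ez, ez]
  ring

end IsHadamardSeq

/-- `liZeroBox T` is the box `weilZeroIndex T` of the explicit-formula files. [folklore] -/
private theorem liZeroBox_eq_weilZeroIndex' (T : ℝ) : liZeroBox T = weilZeroIndex T := by
  ext ρ
  simp only [liZeroBox, weilZeroIndex, mem_setOf_eq, abs_pos]

/-- `n! · C(a+n−1, n) = a(a+1)⋯(a+n−1)` (the rising factorial). [folklore] -/
private theorem factorial_mul_choose_eq_prod {R : Type*} [Field R] [CharZero R] (a : R) (n : ℕ) :
    (n ! : R) * Ring.choose (a + n - 1) n = ∏ j ∈ Finset.range n, (a + j) := by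
  rw [Ring.choose_eq_smul, smul_eq_mul, ← mul_assoc,
    mul_inv_cancel₀ (by exact_mod_cast Nat.factorial_ne_zero n), one_mul,
    Polynomial.descPochhammer_smeval_eq_ascPochhammer, show a + n - 1 - (n : R) + 1 = a by ring,
    Polynomial.ascPochhammer_smeval_eq_eval]
  induction n with
  | zero => simp
  | succ n ih => rw [ascPochhammer_succ_eval, ih, Finset.prod_range_succ]

/-- `Σ_ρ m(ρ)/|ρ|² < ∞` over the zero subtype. [folklore] -/
private theorem summable_zeroOrder_div_norm_sq' :
    Summable (fun ρ : ZetaZeros.riemannZetaNontrivialZeros ↦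
      (riemannZetaZeroOrder (ρ : ℂ) : ℝ) / ‖(ρ : ℂ)‖ ^ 2) :=
  summable_zeros_of_le (C := 1) (R := 1) le_rfl
    (fun ρ ↦ div_nonneg (ZetaZeroSum.zeroOrder_nonneg ρ) (by positivity)) fun ρ _ ↦ by rw [one_mul]

/-! ## Theorem 5.6: the expansion of `F(x,τ)` with the coefficients `ℓ_k(τ)`

Proof as printed (p0011:L64–84): `(ρ/(ρ−τ))ˣ = (1 + τ/(ρ−τ))ˣ = Σ_k C(x,k) (τ/(ρ−τ))ᵏ` (binomial
series, `|τ/(ρ−τ)| < 1`), and the power sums at `τ`: `Σ_ρ m(ρ) Re (ρ−τ)^{−(k+1)} = −ℓ_k(τ)` (the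
partial fractions of `ξ'/ξ` differentiated `k` times at `s = τ`, this file's
`IsHadamardSeq.hasSum_iteratedDeriv_term_at`). -/

section ThmFiveSix

open ZetaZeros

/-- `n! · C(a, n) = a(a−1)⋯(a−n+1)`. [folklore] -/
private theorem factorial_mul_choose_eq_prod_sub {R : Type*} [Field R] [CharZero R] (a : R) (n : ℕ) :
    (n ! : R) * Ring.choose a n = ∏ j ∈ Finset.range n, (a - j) := by
  have h := factorial_mul_choose_eq_prod (a - n + 1) n
  rw [show a - (n : R) + 1 + n - 1 = a by ring] at h
  rw [h, ← Finset.prod_range_reflect]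
  refine Finset.prod_congr rfl fun j hj ↦ ?_
  have hj := Finset.mem_range.1 hj
  rw [Nat.cast_sub (by omega), Nat.cast_sub (by omega)]
  push_cast
  ring

/-- The binomial series `(1+t)ˣ = Σ_n [Π_{j<n}(x−j)/n!] tⁿ` for `‖t‖ < 1`, real `x`.
[cite: Freitas2006LiHalfPlanes, proof of Theorem 5.6 (arXiv p0011:L66)] -/
theorem hasSum_one_add_cpow' {t : ℂ} (ht : ‖t‖ < 1) (x : ℝ) :
    HasSum (fun n : ℕ ↦ (((∏ j ∈ Finset.range n, (x - (j : ℝ))) / (n ! : ℝ) : ℝ) : ℂ) * t ^ n)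
      ((1 + t) ^ (x : ℂ)) := by
  have P := Complex.one_add_cpow_hasFPowerSeriesOnBall_zero (a := (x : ℂ))
  have hmem : t ∈ Metric.eball (0 : ℂ) 1 := by
    rw [show (1 : ENNReal) = ENNReal.ofReal 1 by simp, Metric.eball_ofReal]
    simpa using ht
  have H := P.hasSum hmem
  simp only [zero_add, binomialSeries, FormalMultilinearSeries.ofScalars_apply_eq, smul_eq_mul] at H
  refine H.congr_fun fun n ↦ ?_
  have hn : (n ! : ℂ) ≠ 0 := by exact_mod_cast Nat.factorial_ne_zero n
  have key := factorial_mul_choose_eq_prod_sub ((x : ℂ)) n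
  rw [show Ring.choose (x : ℂ) n = (∏ j ∈ Finset.range n, ((x : ℂ) - j)) / (n ! : ℂ) by
    rw [← key]; field_simp]
  push_cast
  ring

/-- `|ρ|²/2 ≤ |ρ − τ|²` for a non-trivial zero `ρ` and real `τ` (`|Im ρ| > 14 > Re ρ`). [folklore] -/
private theorem norm_sq_half_le (ρ : ZetaZeros.riemannZetaNontrivialZeros) (τ : ℝ) :
    ‖(ρ : ℂ)‖ ^ 2 / 2 ≤ ‖(ρ : ℂ) - τ‖ ^ 2 := by
  have h14 := FordL33.fourteen_lt_abs_im ρ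
  have hre0 := riemannZetaNontrivialZeros.re_pos ρ.2
  have hre1 := riemannZetaNontrivialZeros.re_lt_one ρ.2
  rw [Complex.sq_norm, Complex.sq_norm, Complex.normSq_apply, Complex.normSq_apply]
  simp only [Complex.sub_re, Complex.ofReal_re, Complex.sub_im, Complex.ofReal_im, sub_zero]
  have : ((ρ : ℂ)).re * ((ρ : ℂ)).re ≤ ((ρ : ℂ)).im * ((ρ : ℂ)).im := by
    rw [← abs_mul_abs_self ((ρ : ℂ)).im]
    nlinarith
  nlinarith [sq_nonneg (((ρ : ℂ)).re - τ)]

/-- `14 < |ρ − τ|`. [folklore] -/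
private theorem fourteen_lt_norm_sub (ρ : ZetaZeros.riemannZetaNontrivialZeros) (τ : ℝ) :
    (14 : ℝ) < ‖(ρ : ℂ) - τ‖ := by
  refine lt_of_lt_of_le (FordL33.fourteen_lt_abs_im ρ) ?_
  have := Complex.abs_im_le_norm ((ρ : ℂ) - τ)
  simpa using this

/-- **The power sums at `τ`**: for real `τ` and every `j`, `Σ_ρ m(ρ) Re (ρ−τ)^{−(j+1)}` converges
absolutely and equals `−ℓ_j(τ)`. [cite: Freitas2006LiHalfPlanes, proof of Theorem 5.6 (arXiv p0011:L72)] -/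
theorem hasSum_zeroOrder_mul_re_inv_sub_pow (τ : ℝ) (j : ℕ) :
    HasSum (fun ρ : ZetaZeros.riemannZetaNontrivialZeros ↦
      (riemannZetaZeroOrder (ρ : ℂ) : ℝ) * ((((ρ : ℂ) - τ)⁻¹) ^ (j + 1)).re) (-freitasEllCoeff τ j) := by
  classical
  obtain ⟨b, hb⟩ := exists_isHadamardSeq 0
  have hξτ : riemannXi τ ≠ 0 := (riemannXi_ofReal_pos τ).ne'
  -- absolute summability
  have hsum : Summable (fun ρ : ZetaZeros.riemannZetaNontrivialZeros ↦
      (riemannZetaZeroOrder (ρ : ℂ) : ℝ) * ((((ρ : ℂ) - τ)⁻¹) ^ (j + 1)).re) := by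
    refine Summable.of_norm ?_
    refine summable_zeros_of_le (C := 2 * (1 + |τ|)) (R := 1) le_rfl (fun ρ ↦ norm_nonneg _)
      fun ρ _ ↦ ?_
    have hm : (0 : ℝ) ≤ riemannZetaZeroOrder (ρ : ℂ) := ZetaZeroSum.zeroOrder_nonneg ρ
    have hre0 := riemannZetaNontrivialZeros.re_pos ρ.2
    have hρn : 0 < ‖(ρ : ℂ)‖ := norm_pos_iff.2 (zero_ne_zero' ρ)
    have hd := norm_sq_half_le ρ τ
    have hdpos : 0 < ‖(ρ : ℂ) - τ‖ := norm_pos_iff.2 (sub_ne_zero.2 (zero_ne_ofReal ρ τ))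
    rw [Real.norm_eq_abs, abs_mul, abs_of_nonneg hm,
      show 2 * (1 + |τ|) * ((riemannZetaZeroOrder (ρ : ℂ) : ℝ) / ‖(ρ : ℂ)‖ ^ 2) =
        (riemannZetaZeroOrder (ρ : ℂ) : ℝ) * (2 * (1 + |τ|) / ‖(ρ : ℂ)‖ ^ 2) by ring]
    refine mul_le_mul_of_nonneg_left ?_ hm
    rcases Nat.eq_zero_or_pos j with rfl | hj
    · have hρ2 : (0 : ℝ) < ‖(ρ : ℂ) - τ‖ ^ 2 := by positivity
      rw [zero_add, pow_one, Complex.inv_re, Complex.normSq_eq_norm_sq, abs_div, abs_of_pos hρ2]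
      simp only [Complex.sub_re, Complex.ofReal_re]
      rw [div_le_iff₀ hρ2]
      have h1 : |((ρ : ℂ)).re - τ| ≤ 1 + |τ| := by
        refine (abs_sub _ _).trans ?_
        rw [abs_of_pos hre0]
        linarith [riemannZetaNontrivialZeros.re_lt_one ρ.2]
      calc |((ρ : ℂ)).re - τ| ≤ 1 + |τ| := h1
        _ = (2 * (1 + |τ|)) / ‖(ρ : ℂ)‖ ^ 2 * (‖(ρ : ℂ)‖ ^ 2 / 2) := by field_simp
        _ ≤ (2 * (1 + |τ|)) / ‖(ρ : ℂ)‖ ^ 2 * ‖(ρ : ℂ) - τ‖ ^ 2 :=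
            mul_le_mul_of_nonneg_left hd (by positivity)
    · have h196 : (1 : ℝ) ≤ ‖(ρ : ℂ) - τ‖ := by linarith [fourteen_lt_norm_sub ρ τ]
      calc |((((ρ : ℂ) - τ)⁻¹) ^ (j + 1)).re| ≤ ‖(((ρ : ℂ) - τ)⁻¹) ^ (j + 1)‖ :=
            Complex.abs_re_le_norm _
        _ = (‖(ρ : ℂ) - τ‖ ^ (j + 1))⁻¹ := by rw [norm_pow, norm_inv, inv_pow]
        _ ≤ (‖(ρ : ℂ) - τ‖ ^ 2)⁻¹ := inv_anti₀ (by positivity) (pow_le_pow_right₀ h196 (by omega))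
        _ ≤ (‖(ρ : ℂ)‖ ^ 2 / 2)⁻¹ := inv_anti₀ (by positivity) hd
        _ = 2 / ‖(ρ : ℂ)‖ ^ 2 := by rw [inv_div]
        _ ≤ 2 * (1 + |τ|) / ‖(ρ : ℂ)‖ ^ 2 := by
            refine div_le_div_of_nonneg_right ?_ (by positivity); nlinarith [abs_nonneg τ]
  -- the pair sum from the partial fractions of `ξ'/ξ`, differentiated `j` times at `τ`
  obtain ⟨F, hF⟩ : ∃ F : ℂ → ℂ, F = fun ρ : ℂ ↦ ((ρ - (τ : ℂ))⁻¹) ^ (j + 1) := ⟨_, rfl⟩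
  obtain ⟨GC, hGC⟩ : ∃ GC : ℕ → ℂ, GC = fun k ↦ if b k = 0 then 0 else
    F (IsHadamardSeq.xiZero b k) + F (1 - IsHadamardSeq.xiZero b k) := ⟨_, rfl⟩
  have hD := hb.hasSum_iteratedDeriv_term_at hξτ j
  set L : ℂ := -((j ! : ℂ))⁻¹ * iteratedDeriv j (logDeriv riemannXi) τ with hL
  have hGCsum : HasSum GC L := by
    have H := hD.mul_left (-((j ! : ℂ))⁻¹)
    refine H.congr_fun fun k ↦ ?_
    by_cases hk : b k = 0
    · rw [hGC]; simp [hk]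
    · rw [hGC, hb.iteratedDeriv_term_at hk hξτ j, hF]
      simp only [hk, if_false]
      have hj : (j ! : ℂ) ≠ 0 := by exact_mod_cast Nat.factorial_ne_zero j
      have e1 : ((τ : ℂ) - IsHadamardSeq.xiZero b k)⁻¹ = -((IsHadamardSeq.xiZero b k - τ)⁻¹) := by
        rw [← neg_sub, neg_inv]
      have e2 : ((τ : ℂ) - (1 - IsHadamardSeq.xiZero b k))⁻¹ =
          -((1 - IsHadamardSeq.xiZero b k - τ)⁻¹) := by rw [← neg_sub, neg_inv]
      rw [e1, e2, neg_pow, neg_pow ((1 - IsHadamardSeq.xiZero b k - ↑τ)⁻¹), pow_succ (-1 : ℂ) j]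
      have hu : ((-1 : ℂ) ^ j) * (-1) ^ j = 1 := by
        rw [← pow_add, ← two_mul, pow_mul, neg_one_sq, one_pow]
      field_simp
      linear_combination (-(((IsHadamardSeq.xiZero b k - ↑τ)⁻¹) ^ (j + 1)) -
        ((1 - IsHadamardSeq.xiZero b k - ↑τ)⁻¹) ^ (j + 1)) * hu
  -- transfer to the zeros with multiplicity (as in Lemma 3.1 (i))
  set K : ℝ → Finset ℕ := fun T ↦ (hb.finite_setOf_abs_im_xiZero_le T).toFinset with hKdef
  have hK : ∀ T k, k ∈ K T ↔ b k ≠ 0 ∧ |(IsHadamardSeq.xiZero b k).im| ≤ T := fun T k ↦ by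
    simp [hKdef, Set.Finite.mem_toFinset]
  have hlim : Tendsto (fun T ↦ ∑ k ∈ K T, GC k) atTop (𝓝 L) :=
    IsHadamardSeq.tendsto_sum_truncation hGCsum (fun k hk ↦ by simp [hGC, hk]) K hK
  have heq : ∀ T, ∑ᶠ ρ ∈ liZeroBox T, (riemannZetaZeroOrder ρ : ℂ) * F ρ = ∑ k ∈ K T, GC k := by
    intro T
    rw [hb.finsum_liZeroBox_eq_sum F T (K T) (hK T)]
    refine Finset.sum_congr rfl fun k hk ↦ ?_
    simp [hGC, ((hK T k).1 hk).1]
  have hbox : Tendsto (fun T ↦ (∑ᶠ ρ ∈ liZeroBox T, (riemannZetaZeroOrder ρ : ℂ) * F ρ).re)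
      atTop (𝓝 L.re) := by
    have h1 : Tendsto (fun T ↦ ∑ᶠ ρ ∈ liZeroBox T, (riemannZetaZeroOrder ρ : ℂ) * F ρ)
        atTop (𝓝 L) := by simpa only [heq] using hlim
    exact (Complex.continuous_re.tendsto _).comp h1
  set Φ : ZetaZeros.riemannZetaNontrivialZeros → ℝ := fun ρ ↦
    (riemannZetaZeroOrder (ρ : ℂ) : ℝ) * ((((ρ : ℂ) - τ)⁻¹) ^ (j + 1)).re with hΦ
  have hlim2 := hsum.hasSum.comp tendsto_weilZeroFinset
  have hident : ∀ T, (∑ᶠ ρ ∈ liZeroBox T, (riemannZetaZeroOrder ρ : ℂ) * F ρ).re =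
      ∑ ρ ∈ weilZeroFinset T, Φ ρ := by
    intro T
    rw [liZeroBox_eq_weilZeroIndex', ZetaZeroSum.finsum_mem_weilZeroIndex_eq_sum, Complex.re_sum]
    refine Finset.sum_congr rfl fun ρ _ ↦ ?_
    simp only [hΦ, hF, Complex.mul_re, Complex.intCast_re, Complex.intCast_im, zero_mul, sub_zero]
  have hbox' : Tendsto (fun T ↦ ∑ ρ ∈ weilZeroFinset T, Φ ρ) atTop (𝓝 L.re) :=
    hbox.congr fun T ↦ hident T
  have huniq := tendsto_nhds_unique hlim2 hbox'
  have hval : L.re = -freitasEllCoeff τ j := by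
    rw [hL, freitasEllCoeff, ← Complex.neg_re]
    congr 1
    rw [div_eq_mul_inv]
    ring
  rw [← hval, ← huniq]
  exact hsum.hasSum

/-- A uniform gap: if `|τ| < |ρ − τ|` for every zero then `|τ| ≤ s|ρ − τ|` for every zero, for some
`s < 1`. [folklore] -/
private theorem exists_ratio_lt_one' {τ : ℝ}
    (hτρ : ∀ ρ ∈ ZetaZeros.riemannZetaNontrivialZeros, |τ| < ‖ρ - τ‖) :
    ∃ s : ℝ, 1 / 2 ≤ s ∧ s < 1 ∧
      ∀ ρ : ZetaZeros.riemannZetaNontrivialZeros, |τ| ≤ s * ‖(ρ : ℂ) - τ‖ := by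
  classical
  set S : Finset ZetaZeros.riemannZetaNontrivialZeros := weilZeroFinset (2 * |τ|) with hS
  have hoff : ∀ ρ : ZetaZeros.riemannZetaNontrivialZeros, ρ ∉ S →
      |τ| ≤ 1 / 2 * ‖(ρ : ℂ) - τ‖ := by
    intro ρ hρ
    rw [hS, mem_weilZeroFinset, not_le] at hρ
    have h1 : |((ρ : ℂ) - τ).im| ≤ ‖(ρ : ℂ) - τ‖ := Complex.abs_im_le_norm _
    simp only [Complex.sub_im, Complex.ofReal_im, sub_zero] at h1
    linarith
  by_cases hne : S.Nonempty
  · obtain ⟨ρ₀, hρ₀, hmax⟩ := S.exists_max_image (fun ρ ↦ |τ| / ‖(ρ : ℂ) - τ‖) hne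
    have hρ₀n : 0 < ‖(ρ₀ : ℂ) - τ‖ := norm_pos_iff.2 (sub_ne_zero.2 (zero_ne_ofReal ρ₀ τ))
    set s : ℝ := max (1 / 2) (|τ| / ‖(ρ₀ : ℂ) - τ‖) with hs
    refine ⟨s, le_max_left _ _, max_lt (by norm_num) ((div_lt_one hρ₀n).2 (hτρ _ ρ₀.2)),
      fun ρ ↦ ?_⟩
    have hρn : 0 < ‖(ρ : ℂ) - τ‖ := norm_pos_iff.2 (sub_ne_zero.2 (zero_ne_ofReal ρ τ))
    by_cases hmem : ρ ∈ S
    · have h1 : |τ| / ‖(ρ : ℂ) - τ‖ ≤ s := (hmax ρ hmem).trans (le_max_right _ _)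
      rwa [div_le_iff₀ hρn] at h1
    · exact (hoff ρ hmem).trans (mul_le_mul_of_nonneg_right (le_max_left _ _) (norm_nonneg _))
  · refine ⟨1 / 2, le_rfl, by norm_num, fun ρ ↦ hoff ρ fun h ↦ hne ⟨ρ, h⟩⟩

/-- **Freitas 2006, Theorem 5.6** — DISCHARGED (real `x`, `|τ| < |ρ − τ|` for every zero):
`F(x,τ) = Σ_{k≥0} [x(x−1)⋯(x−k)/(k+1)!] ℓ_k(τ) τᵏ`. [cite: Freitas2006LiHalfPlanes, Theorem 5.6] -/
theorem Freitas2006_thm_5_6_holds : Freitas2006_thm_5_6 := by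
  intro x τ hτρ
  obtain ⟨c, hc⟩ : ∃ c : ℕ → ℝ, c = fun n ↦ (∏ j ∈ Finset.range n, (x - (j : ℝ))) / (n ! : ℝ) :=
    ⟨_, rfl⟩
  have hcn : ∀ n, (∏ j ∈ Finset.range n, (x - (j : ℝ))) / (n ! : ℝ) = c n := fun n ↦ by rw [hc]
  have hc0 : c 0 = 1 := by rw [hc]; simp
  by_cases hτ : τ = 0
  · subst hτ
    have hval : freitasF x 0 = (∏ j ∈ Finset.range (0 + 1), (x - j)) / ((0 + 1)! : ℝ) *
        freitasEllCoeff 0 0 * (0 : ℝ) ^ 0 := by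
      simp [freitasF, freitasEllCoeff]
    rw [hval]
    refine hasSum_single 0 fun k hk ↦ ?_
    simp [zero_pow hk]
  obtain ⟨s, hs12, hs1, hsρ⟩ := exists_ratio_lt_one' hτρ
  have hs0 : 0 < s := by linarith
  set m : ZetaZeros.riemannZetaNontrivialZeros → ℝ := fun ρ ↦ (riemannZetaZeroOrder (ρ : ℂ) : ℝ)
    with hm
  have hm0 : ∀ ρ, 0 ≤ m ρ := fun ρ ↦ ZetaZeroSum.zeroOrder_nonneg ρ
  -- `Σ |c n| sⁿ < ∞` from the real binomial series
  have hcs : Summable (fun n : ℕ ↦ |c n| * s ^ n) := by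
    have P := Real.one_add_rpow_hasFPowerSeriesOnBall_zero (a := x)
    have hr : ((s.toNNReal : NNReal) : ENNReal) < (binomialSeries ℝ x).radius := by
      refine lt_of_lt_of_le ?_ P.r_le
      exact ENNReal.coe_lt_one_iff.2 (Real.toNNReal_lt_one.2 hs1)
    have H := FormalMultilinearSeries.summable_norm_mul_pow _ hr
    refine H.congr fun n ↦ ?_
    rw [binomialSeries, FormalMultilinearSeries.ofScalars_norm, Real.norm_eq_abs,
      Real.coe_toNNReal _ hs0.le]
    congr 2
    have key := factorial_mul_choose_eq_prod_sub x n
    have hn : (n ! : ℝ) ≠ 0 := by positivity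
    rw [hc]
    simp only
    rw [← key]
    field_simp
  -- the double family
  set G : ZetaZeros.riemannZetaNontrivialZeros × ℕ → ℝ := fun q ↦
    -(m q.1 * (c (q.2 + 1) * τ ^ (q.2 + 1) * ((((q.1 : ℂ) - τ)⁻¹) ^ (q.2 + 1)).re)) with hG
  set A : ℕ → ℝ := fun n ↦ 2 * (|c (n + 1)| * s ^ (n + 1) * (τ ^ 2 / s ^ 2)) +
    (if n = 0 then 2 * (|c 1| * |τ| * (1 + |τ|)) else 0) with hA
  have hA0 : ∀ n, 0 ≤ A n := fun n ↦ by
    rw [hA]; simp only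
    refine add_nonneg (by positivity) ?_
    split_ifs <;> positivity
  have hAs : Summable A := by
    have h1 : Summable (fun n : ℕ ↦ 2 * (|c (n + 1)| * s ^ (n + 1) * (τ ^ 2 / s ^ 2))) :=
      (((summable_nat_add_iff 1).2 hcs).mul_right (τ ^ 2 / s ^ 2)).mul_left 2
    have h2 : Summable (fun n : ℕ ↦ if n = 0 then 2 * (|c 1| * |τ| * (1 + |τ|)) else 0) :=
      summable_of_hasFiniteSupport ((Set.finite_singleton 0).subset fun n hn ↦ by
        by_contra h
        have hn0 : n ≠ 0 := fun e ↦ h (by simp [e])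
        exact hn (by simp [hn0]))
    exact h1.add h2
  have hdom : ∀ q : ZetaZeros.riemannZetaNontrivialZeros × ℕ,
      ‖G q‖ ≤ (m q.1 / ‖(q.1 : ℂ)‖ ^ 2) * A q.2 := by
    rintro ⟨ρ, n⟩
    have hρ := norm_pos_iff.2 (zero_ne_zero' ρ)
    have hd := norm_sq_half_le ρ τ
    have hdpos : 0 < ‖(ρ : ℂ) - τ‖ := norm_pos_iff.2 (sub_ne_zero.2 (zero_ne_ofReal ρ τ))
    have hρ2 : (0 : ℝ) < ‖(ρ : ℂ)‖ ^ 2 := by positivity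
    have hinv : (‖(ρ : ℂ) - τ‖ ^ 2)⁻¹ ≤ 2 / ‖(ρ : ℂ)‖ ^ 2 := by
      rw [← inv_div]; exact inv_anti₀ (by positivity) hd
    rw [Real.norm_eq_abs]
    show |-(m ρ * (c (n + 1) * τ ^ (n + 1) * ((((ρ : ℂ) - τ)⁻¹) ^ (n + 1)).re))| ≤
      (m ρ / ‖(ρ : ℂ)‖ ^ 2) * A n
    rw [abs_neg, abs_mul, abs_of_nonneg (hm0 ρ), div_mul_eq_mul_div, mul_div_assoc]
    refine mul_le_mul_of_nonneg_left ?_ (hm0 ρ)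
    rw [abs_mul, abs_mul, abs_pow]
    rcases Nat.eq_zero_or_pos n with rfl | hn
    · have hre0 := riemannZetaNontrivialZeros.re_pos ρ.2
      have hre1 := riemannZetaNontrivialZeros.re_lt_one ρ.2
      simp only [zero_add, pow_one, hA, if_true]
      have hdτ2 : (0 : ℝ) < ‖(ρ : ℂ) - τ‖ ^ 2 := by positivity
      have hre : |(((ρ : ℂ) - τ)⁻¹).re| ≤ (1 + |τ|) * (‖(ρ : ℂ) - τ‖ ^ 2)⁻¹ := by
        rw [Complex.inv_re, Complex.normSq_eq_norm_sq, abs_div, abs_of_pos hdτ2, div_eq_mul_inv]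
        refine mul_le_mul_of_nonneg_right ?_ (by positivity)
        simp only [Complex.sub_re, Complex.ofReal_re]
        refine (abs_sub _ _).trans ?_
        rw [abs_of_pos hre0]; linarith
      have hfirst : 0 ≤ 2 * (|c 1| * s * (τ ^ 2 / s ^ 2)) := by positivity
      calc |c 1| * |τ| * |(((ρ : ℂ) - τ)⁻¹).re|
          ≤ |c 1| * |τ| * ((1 + |τ|) * (2 / ‖(ρ : ℂ)‖ ^ 2)) := by
            refine mul_le_mul_of_nonneg_left (hre.trans ?_) (by positivity)
            exact mul_le_mul_of_nonneg_left hinv (by positivity)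
        _ = 2 * (|c 1| * |τ| * (1 + |τ|)) / ‖(ρ : ℂ)‖ ^ 2 := by ring
        _ ≤ (2 * (|c 1| * s * (τ ^ 2 / s ^ 2)) + 2 * (|c 1| * |τ| * (1 + |τ|))) / ‖(ρ : ℂ)‖ ^ 2 :=
            div_le_div_of_nonneg_right (by linarith) hρ2.le
    · simp only [hA, show n ≠ 0 by omega, if_false, add_zero]
      have hre : |((((ρ : ℂ) - τ)⁻¹) ^ (n + 1)).re| ≤ (‖(ρ : ℂ) - τ‖ ^ (n + 1))⁻¹ := by
        refine (Complex.abs_re_le_norm _).trans ?_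
        rw [norm_pow, norm_inv, inv_pow]
      obtain ⟨k, rfl⟩ : ∃ k, n = k + 1 := ⟨n - 1, by omega⟩
      have hτk : |τ| ^ k ≤ (s * ‖(ρ : ℂ) - τ‖) ^ k := pow_le_pow_left₀ (abs_nonneg τ) (hsρ ρ) _
      calc |c (k + 1 + 1)| * |τ| ^ (k + 1 + 1) * |((((ρ : ℂ) - τ)⁻¹) ^ (k + 1 + 1)).re|
          ≤ |c (k + 1 + 1)| * (τ ^ 2 * (s * ‖(ρ : ℂ) - τ‖) ^ k) * (‖(ρ : ℂ) - τ‖ ^ (k + 1 + 1))⁻¹ := by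
            refine mul_le_mul (mul_le_mul_of_nonneg_left ?_ (abs_nonneg _)) hre (abs_nonneg _)
              (by positivity)
            rw [show |τ| ^ (k + 1 + 1) = τ ^ 2 * |τ| ^ k by rw [← sq_abs]; ring]
            exact mul_le_mul_of_nonneg_left hτk (by positivity)
        _ = |c (k + 1 + 1)| * s ^ k * τ ^ 2 * (‖(ρ : ℂ) - τ‖ ^ 2)⁻¹ := by
            field_simp
            ring
        _ ≤ |c (k + 1 + 1)| * s ^ k * τ ^ 2 * (2 / ‖(ρ : ℂ)‖ ^ 2) :=
            mul_le_mul_of_nonneg_left hinv (by positivity)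
        _ = 2 * (|c (k + 1 + 1)| * s ^ (k + 1 + 1) * (τ ^ 2 / s ^ 2)) / ‖(ρ : ℂ)‖ ^ 2 := by
            field_simp
            ring
  have hprod : Summable (fun q : ZetaZeros.riemannZetaNontrivialZeros × ℕ ↦
      (m q.1 / ‖(q.1 : ℂ)‖ ^ 2) * A q.2) :=
    summable_zeroOrder_div_norm_sq'.mul_of_nonneg hAs
      (fun ρ ↦ div_nonneg (hm0 ρ) (by positivity)) hA0
  have hGsum : Summable G := Summable.of_norm_bounded hprod hdom
  -- fibres over `ρ`
  have hfib : ∀ ρ : ZetaZeros.riemannZetaNontrivialZeros, HasSum (fun n ↦ G (ρ, n))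
      (m ρ * (1 - ((ρ : ℂ) / ((ρ : ℂ) - τ)) ^ (x : ℂ)).re) := by
    intro ρ
    have hρ0 := zero_ne_zero' ρ
    have hρτ : (ρ : ℂ) - τ ≠ 0 := sub_ne_zero.2 (zero_ne_ofReal ρ τ)
    have hρτn := norm_pos_iff.2 hρτ
    set t : ℂ := (τ : ℂ) / ((ρ : ℂ) - τ) with ht
    have ht1 : ‖t‖ < 1 := by
      rw [ht, norm_div, Complex.norm_real, Real.norm_eq_abs, div_lt_one hρτn]
      exact hτρ _ ρ.2
    have H := hasSum_one_add_cpow' ht1 x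
    have hu : 1 + t = (ρ : ℂ) / ((ρ : ℂ) - τ) := by rw [ht]; field_simp; ring
    rw [hu] at H
    simp only [hcn] at H
    have H1 := (hasSum_nat_add_iff' 1).2 H
    rw [Finset.sum_range_one, pow_zero, mul_one, hc0, Complex.ofReal_one] at H1
    have H2 := (H1.mapL Complex.reCLM).mul_left (-m ρ)
    simp only [Complex.reCLM_apply] at H2
    have hfun : (fun n ↦ G (ρ, n)) =
        fun n ↦ -m ρ * ((((c (n + 1)) : ℝ) : ℂ) * t ^ (n + 1)).re := by
      funext n
      show -(m ρ * (c (n + 1) * τ ^ (n + 1) * ((((ρ : ℂ) - τ)⁻¹) ^ (n + 1)).re)) =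
        -m ρ * ((((c (n + 1)) : ℝ) : ℂ) * t ^ (n + 1)).re
      rw [show ((c (n + 1) : ℝ) : ℂ) * t ^ (n + 1) =
        (((c (n + 1) * τ ^ (n + 1) : ℝ)) : ℂ) * ((((ρ : ℂ) - τ))⁻¹) ^ (n + 1) by
          rw [ht, div_eq_mul_inv, mul_pow]; push_cast; ring, Complex.re_ofReal_mul]
      ring
    have hval : m ρ * (1 - ((ρ : ℂ) / ((ρ : ℂ) - τ)) ^ (x : ℂ)).re =
        -m ρ * (((ρ : ℂ) / ((ρ : ℂ) - τ)) ^ (x : ℂ) - 1).re := by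
      rw [Complex.sub_re, Complex.sub_re, Complex.one_re]; ring
    rw [hfun, hval]
    exact H2
  have h1 : HasSum (fun ρ : ZetaZeros.riemannZetaNontrivialZeros ↦
      m ρ * (1 - ((ρ : ℂ) / ((ρ : ℂ) - τ)) ^ (x : ℂ)).re) (∑' q, G q) :=
    hGsum.hasSum.prod_fiberwise hfib
  -- fibres over `n`
  have hswap : HasSum (G ∘ (Equiv.prodComm ℕ ZetaZeros.riemannZetaNontrivialZeros))
      (∑' q, G q) := (Equiv.hasSum_iff _).2 hGsum.hasSum
  have hfib2 : ∀ n : ℕ, HasSum (fun ρ : ZetaZeros.riemannZetaNontrivialZeros ↦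
      (G ∘ (Equiv.prodComm ℕ ZetaZeros.riemannZetaNontrivialZeros)) (n, ρ))
      (-(c (n + 1) * τ ^ (n + 1)) * (-freitasEllCoeff τ n)) := by
    intro n
    have H := (hasSum_zeroOrder_mul_re_inv_sub_pow τ n).mul_left (-(c (n + 1) * τ ^ (n + 1)))
    refine H.congr_fun fun ρ ↦ ?_
    simp only [Function.comp_apply, Equiv.prodComm_apply, Prod.swap_prod_mk, hG, hm]
    ring
  have h2 : HasSum (fun n : ℕ ↦ -(c (n + 1) * τ ^ (n + 1)) * (-freitasEllCoeff τ n))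
      (∑' q, G q) := hswap.prod_fiberwise hfib2
  have hF : freitasF x τ = τ⁻¹ * ∑' q, G q := by
    rw [freitasF, if_neg hτ, h1.tsum_eq]
  rw [hF]
  have h3 := h2.mul_left τ⁻¹
  refine h3.congr_fun fun n ↦ ?_
  have e1 : τ⁻¹ * (-(c (n + 1) * τ ^ (n + 1)) * (-freitasEllCoeff τ n)) =
      c (n + 1) * τ ^ n * freitasEllCoeff τ n := by
    rw [pow_succ]
    field_simp
  rw [e1, ← hcn (n + 1)]
  ring

end ThmFiveSix

/-! ## Theorem 5.5: `F` takes negative values near `τ = 0` for large `x`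

From Theorem 5.1, `F(x,τ) = xℓ₀ + Σ_{k≥1} ℓ_k x(x+1)⋯(x+k) τᵏ/(k+1)!` with `ℓ₀ < 0`
(p0011:L33–45, "since `ℓ₀` is negative"); the tail is at most `14M Σ_{k≥1} c_{k+1} sᵏ =
14M[(1−s)^{−x} − 1 − xs]/s ≤ Mτ(4x+2)·x` (`s = τ/14`, `|ℓ_k| ≤ 14^{1−k}M`, `M = Σ_ρ m(ρ)/|ρ|²`),
which is `< x|ℓ₀|` once `xτ` and `τ` are small. -/

section ThmFiveFive

open ZetaZeros

/-- **`ℓ₀ = log(2√π) − 1 − γ/2 < 0`** (numerically `≈ −0.0231`; p0011:L40 "since `ℓ₀` is negative"):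
`log 2 < 0.69315`, `log π < 1.15` (`π < 3.1416 < (1 + 0.14375 + 0.14375²/2)⁸ ≤ e^{1.15}`),
`γ > 0.5772`. [cite: Freitas2006LiHalfPlanes, proof of Theorem 5.5 (arXiv p0011:L40)] -/
theorem freitasEllCoeff_zero_zero_neg : freitasEllCoeff 0 0 < 0 := by
  rw [Freitas2006_ell_coeff_holds.1]
  have h2 := Real.log_two_lt_d9
  have hγ := Literature.Analysis.SpecialFunctions.Real.eulerMascheroniConstant_gt_d16
  have hπ : Real.log Real.pi < 1.15 := by
    rw [Real.log_lt_iff_lt_exp Real.pi_pos]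
    have h1 : (1.15 : ℝ) = (8 : ℕ) * (0.14375 : ℝ) := by norm_num
    rw [h1, Real.exp_nat_mul]
    have hq := Real.quadratic_le_exp_of_nonneg (show (0 : ℝ) ≤ 0.14375 by norm_num)
    calc Real.pi < 3.1416 := Real.pi_lt_d4
      _ < (1 + 0.14375 + 0.14375 ^ 2 / 2) ^ 8 := by norm_num
      _ ≤ Real.exp 0.14375 ^ 8 := pow_le_pow_left₀ (by norm_num) hq 8
  rw [Real.log_mul two_ne_zero (Real.sqrt_ne_zero'.2 Real.pi_pos), Real.log_sqrt Real.pi_pos.le]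
  linarith

/-- **`|ℓ_k| ≤ 14^{1−k} Σ_ρ m(ρ)/|ρ|²`** for `k ≥ 1` (`ℓ_k = −Σ_ρ m(ρ) Re ρ^{−(k+1)}`, `|ρ| > 14`).
[cite: Freitas2006LiHalfPlanes, proof of Theorem 5.1 (arXiv p0010:L78)] -/
theorem abs_freitasEllCoeff_zero_le {k : ℕ} (hk : 1 ≤ k) :
    |freitasEllCoeff 0 k| ≤ 14 * (1 / 14) ^ k *
      ∑' ρ : ZetaZeros.riemannZetaNontrivialZeros, (riemannZetaZeroOrder (ρ : ℂ) : ℝ) / ‖(ρ : ℂ)‖ ^ 2 := by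
  rw [freitasEllCoeff_zero_eq_neg_re_zetaZeroPowerSum, abs_neg,
    re_zetaZeroPowerSum_eq_tsum (by omega : 1 ≤ k + 1), ← tsum_mul_left]
  have hS := summable_zeroOrder_mul_re_inv_pow (k := k + 1) (by omega)
  have hM := summable_zeroOrder_div_norm_sq'
  refine (norm_tsum_le_tsum_norm hS.norm).trans ?_
  refine Summable.tsum_le_tsum (fun ρ ↦ ?_) hS.norm (hM.mul_left _)
  have hm : (0 : ℝ) ≤ riemannZetaZeroOrder (ρ : ℂ) := ZetaZeroSum.zeroOrder_nonneg ρ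
  have h14 := FordL33.fourteen_lt_norm ρ
  have hρ : 0 < ‖(ρ : ℂ)‖ := by linarith
  rw [Real.norm_eq_abs, abs_mul, abs_of_nonneg hm,
    show 14 * (1 / 14 : ℝ) ^ k * ((riemannZetaZeroOrder (ρ : ℂ) : ℝ) / ‖(ρ : ℂ)‖ ^ 2) =
      (riemannZetaZeroOrder (ρ : ℂ) : ℝ) * (14 * (1 / 14) ^ k / ‖(ρ : ℂ)‖ ^ 2) by ring]
  refine mul_le_mul_of_nonneg_left ?_ hm
  obtain ⟨j, rfl⟩ : ∃ j, k = j + 1 := ⟨k - 1, by omega⟩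
  calc |((((ρ : ℂ))⁻¹) ^ (j + 1 + 1)).re| ≤ ‖(((ρ : ℂ))⁻¹) ^ (j + 1 + 1)‖ := Complex.abs_re_le_norm _
    _ = (‖(ρ : ℂ)‖ ^ j)⁻¹ * (‖(ρ : ℂ)‖ ^ 2)⁻¹ := by
        rw [norm_pow, norm_inv, inv_pow, ← mul_inv, ← pow_add]
    _ ≤ ((14 : ℝ) ^ j)⁻¹ * (‖(ρ : ℂ)‖ ^ 2)⁻¹ := by
        refine mul_le_mul_of_nonneg_right ?_ (by positivity)
        exact inv_anti₀ (by positivity) (pow_le_pow_left₀ (by norm_num) h14.le j)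
    _ = 14 * (1 / 14) ^ (j + 1) / ‖(ρ : ℂ)‖ ^ 2 := by
        rw [pow_succ, one_div, inv_pow]; field_simp; ring

/-- The real binomial series `Σ_n [x(x+1)⋯(x+n−1)/n!] sⁿ = (1−s)^{−x}` for `0 ≤ s < 1`.
[cite: Freitas2006LiHalfPlanes, proof of Theorem 5.1 (arXiv p0010:L68)] -/
theorem hasSum_inv_one_sub_rpow {s : ℝ} (hs0 : 0 ≤ s) (hs1 : s < 1) (x : ℝ) :
    HasSum (fun n : ℕ ↦ (∏ j ∈ Finset.range n, (x + (j : ℝ))) / (n ! : ℝ) * s ^ n)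
      (((1 - s)⁻¹) ^ x) := by
  have hw : ‖(s : ℂ)‖ < 1 := by rw [Complex.norm_real, Real.norm_eq_abs, abs_of_nonneg hs0]; exact hs1
  have H := (hasSum_inv_one_sub_cpow hw x).mapL Complex.reCLM
  simp only [Complex.reCLM_apply] at H
  have hr : (0 : ℝ) ≤ (1 - s)⁻¹ := inv_nonneg.2 (by linarith)
  convert H using 1
  · funext n
    rw [show (((∏ j ∈ Finset.range n, (x + (j : ℝ))) / (n ! : ℝ) : ℝ) : ℂ) * (s : ℂ) ^ n =
      ((((∏ j ∈ Finset.range n, (x + (j : ℝ))) / (n ! : ℝ) * s ^ n : ℝ)) : ℂ) by push_cast; ring,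
      Complex.ofReal_re]
  · rw [show (1 - (s : ℂ))⁻¹ = ((((1 - s)⁻¹ : ℝ)) : ℂ) by push_cast; ring, ← Complex.ofReal_cpow hr,
      Complex.ofReal_re]

set_option maxHeartbeats 400000 in
/-- **Freitas 2006, Theorem 5.5** — DISCHARGED: there are `τ₀, x₀ > 0` with `F(x,τ) < 0` whenever
`0 < τ`, `x₀ < x < τ₀/τ`.  (We take `x₀ = 1` and `τ₀ = min 1 (|ℓ₀|/(6M+6))`.)
[cite: Freitas2006LiHalfPlanes, Theorem 5.5] -/
theorem Freitas2006_thm_5_5_holds : Freitas2006_thm_5_5 := by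
  set M : ℝ := ∑' ρ : ZetaZeros.riemannZetaNontrivialZeros,
    (riemannZetaZeroOrder (ρ : ℂ) : ℝ) / ‖(ρ : ℂ)‖ ^ 2 with hM
  have hM0 : 0 ≤ M := tsum_nonneg fun ρ ↦ div_nonneg (ZetaZeroSum.zeroOrder_nonneg ρ) (by positivity)
  set L0 : ℝ := freitasEllCoeff 0 0 with hL0
  have hL0neg : L0 < 0 := freitasEllCoeff_zero_zero_neg
  set τ₀ : ℝ := min 1 (-L0 / (6 * M + 6)) with hτ₀
  have hτ₀pos : 0 < τ₀ := lt_min one_pos (div_pos (by linarith) (by linarith))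
  have hτ₀1 : τ₀ ≤ 1 := min_le_left _ _
  have hτ₀2 : 6 * M * τ₀ < -L0 := by
    have h1 : τ₀ ≤ -L0 / (6 * M + 6) := min_le_right _ _
    have h2 : 6 * M * τ₀ ≤ 6 * M * (-L0 / (6 * M + 6)) := mul_le_mul_of_nonneg_left h1 (by linarith)
    have h3 : 6 * M * (-L0 / (6 * M + 6)) < -L0 := by
      rw [mul_div_assoc', div_lt_iff₀ (by linarith)]; nlinarith
    linarith
  refine ⟨τ₀, 1, hτ₀pos, one_pos, fun x τ hτ hx hxτ ↦ ?_⟩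
  have hx0 : 0 < x := by linarith
  have hxτ' : x * τ < τ₀ := by rwa [lt_div_iff₀ hτ] at hxτ
  have hτ1 : τ < τ₀ := by nlinarith
  have hτ14 : τ < 14 := by linarith
  -- Theorem 5.1 applies: `|τ| < 14 < |ρ|`
  have hτρ : ∀ ρ ∈ ZetaZeros.riemannZetaNontrivialZeros, |τ| < ‖ρ‖ := by
    intro ρ hρ
    have := FordL33.fourteen_lt_norm ⟨ρ, hρ⟩
    rw [abs_of_pos hτ]
    exact lt_trans hτ14 this
  have HF := Freitas2006_thm_5_1_holds x τ hτρ
  -- the coefficients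
  obtain ⟨c, hc⟩ : ∃ c : ℕ → ℝ, c = fun n ↦ (∏ j ∈ Finset.range n, (x + (j : ℝ))) / (n ! : ℝ) :=
    ⟨_, rfl⟩
  have hcn : ∀ n, (∏ j ∈ Finset.range n, (x + (j : ℝ))) / (n ! : ℝ) = c n := fun n ↦ by rw [hc]
  have hc0 : c 0 = 1 := by rw [hc]; simp
  have hc1 : c 1 = x := by rw [hc]; simp
  have hcpos : ∀ n, 0 ≤ c n := fun n ↦ by
    rw [hc]; exact div_nonneg (Finset.prod_nonneg fun j _ ↦ by positivity) (by positivity)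
  have HF' : HasSum (fun k : ℕ ↦ freitasEllCoeff 0 k * c (k + 1) * τ ^ k) (freitasF x τ) := by
    refine HF.congr_fun fun k ↦ ?_
    rw [← hcn (k + 1)]; ring
  -- split off `k = 0`
  have HF1 := (hasSum_nat_add_iff' 1).2 HF'
  rw [Finset.sum_range_one, pow_zero, mul_one, zero_add, hc1] at HF1
  -- the comparison series
  set s : ℝ := τ / 14 with hs
  have hs0 : 0 < s := by positivity
  have hs1 : s < 1 / 14 := by rw [hs]; linarith
  have HB := hasSum_inv_one_sub_rpow hs0.le (by linarith) x
  simp only [hcn] at HB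
  have HT := (hasSum_nat_add_iff' 2).2 HB
  rw [Finset.sum_range_succ, Finset.sum_range_one, pow_zero, mul_one, pow_one, hc0, hc1] at HT
  -- termwise bound: `ℓ_{k+1} c_{k+2} τ^{k+1} ≤ (14M/s) c_{k+2} s^{k+2}`
  have hle : ∀ k : ℕ, freitasEllCoeff 0 (k + 1) * c (k + 1 + 1) * τ ^ (k + 1) ≤
      14 * M / s * (c (k + 2) * s ^ (k + 2)) := by
    intro k
    have h1 := abs_freitasEllCoeff_zero_le (k := k + 1) (by omega)
    have h2 : freitasEllCoeff 0 (k + 1) ≤ 14 * (1 / 14) ^ (k + 1) * M := (le_abs_self _).trans h1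
    have h3 : 0 ≤ c (k + 1 + 1) * τ ^ (k + 1) := mul_nonneg (hcpos _) (pow_nonneg hτ.le _)
    calc freitasEllCoeff 0 (k + 1) * c (k + 1 + 1) * τ ^ (k + 1)
        = freitasEllCoeff 0 (k + 1) * (c (k + 1 + 1) * τ ^ (k + 1)) := by ring
      _ ≤ 14 * (1 / 14) ^ (k + 1) * M * (c (k + 1 + 1) * τ ^ (k + 1)) :=
          mul_le_mul_of_nonneg_right h2 h3
      _ = 14 * M / s * (c (k + 2) * s ^ (k + 2)) := by
          rw [hs, show k + 1 + 1 = k + 2 by ring]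
          field_simp
          ring
  have HG := HT.mul_left (14 * M / s)
  have hbound := hasSum_le hle HF1 HG
  -- `(1−s)^{−x} − 1 − xs ≤ s²(4x² + 2x)`
  have hr1 : (1 : ℝ) < (1 - s)⁻¹ := by
    rw [lt_inv_comm₀ one_pos (by linarith), inv_one]; linarith
  have hrpos : (0 : ℝ) < (1 - s)⁻¹ := by linarith
  set v : ℝ := x * (s / (1 - s)) with hv
  have hsv : s / (1 - s) ≤ 2 * s := by
    rw [div_le_iff₀ (by linarith)]; nlinarith
  have h1s : (0 : ℝ) < 1 - s := by linarith
  have h1s' : (1 : ℝ) - s ≠ 0 := h1s.ne'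
  have hv0 : 0 ≤ v := mul_nonneg hx0.le (div_nonneg hs0.le h1s.le)
  have hv2 : v ≤ 2 * (x * s) := by rw [hv]; nlinarith
  have hxs : x * s < 1 / 14 := by
    rw [hs]; rw [mul_div_assoc']; rw [div_lt_div_iff_of_pos_right (by norm_num)]; linarith
  have hv1 : |v| ≤ 1 := by rw [abs_of_nonneg hv0]; linarith
  have hR : ((1 - s)⁻¹) ^ x ≤ Real.exp v := by
    rw [Real.rpow_def_of_pos hrpos]
    refine Real.exp_le_exp.2 ?_
    have hl : Real.log ((1 - s)⁻¹) ≤ (1 - s)⁻¹ - 1 := Real.log_le_sub_one_of_pos hrpos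
    have he : (1 - s)⁻¹ - 1 = s / (1 - s) := by field_simp; ring
    rw [he] at hl
    rw [hv, mul_comm x]
    exact mul_le_mul_of_nonneg_right hl hx0.le
  have hexp : Real.exp v - 1 - v ≤ v ^ 2 := (le_abs_self _).trans (Real.abs_exp_sub_one_sub_id_le hv1)
  have htail : ((1 - s)⁻¹) ^ x - 1 - x * s ≤ s ^ 2 * (4 * x ^ 2 + 2 * x) := by
    have h1 : v - x * s = x * s * (s / (1 - s)) := by rw [hv]; field_simp; ring
    have h2 : v - x * s ≤ 2 * x * s ^ 2 := by
      rw [h1]; nlinarith [mul_nonneg hx0.le hs0.le]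
    have h3 : v ^ 2 ≤ 4 * x ^ 2 * s ^ 2 := by nlinarith
    nlinarith
  -- conclude
  have hfin : freitasF x τ ≤ x * (L0 + M * τ * (4 * x + 2)) := by
    have h1 : freitasF x τ - L0 * x ≤ 14 * M / s * (((1 - s)⁻¹) ^ x - (1 + x * s)) := by
      have := hbound; rw [hL0]; linarith
    have h1' : ((1 - s)⁻¹) ^ x - (1 + x * s) = ((1 - s)⁻¹) ^ x - 1 - x * s := by ring
    rw [h1'] at h1
    have h2 : 14 * M / s * (((1 - s)⁻¹) ^ x - 1 - x * s) ≤ 14 * M / s * (s ^ 2 * (4 * x ^ 2 + 2 * x)) :=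
      mul_le_mul_of_nonneg_left htail (div_nonneg (by linarith) hs0.le)
    have h3 : 14 * M / s * (s ^ 2 * (4 * x ^ 2 + 2 * x)) = x * (M * τ * (4 * x + 2)) := by
      rw [hs]; field_simp
    linarith
  have hneg : L0 + M * τ * (4 * x + 2) < 0 := by
    have h1 : M * τ * (4 * x + 2) = 4 * M * (x * τ) + 2 * M * τ := by ring
    have h2 : 4 * M * (x * τ) ≤ 4 * M * τ₀ := mul_le_mul_of_nonneg_left hxτ'.le (by linarith)
    have h3 : 2 * M * τ ≤ 2 * M * τ₀ := mul_le_mul_of_nonneg_left hτ1.le (by linarith)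
    linarith
  calc freitasF x τ ≤ x * (L0 + M * τ * (4 * x + 2)) := hfin
    _ < 0 := mul_neg_of_pos_of_neg hx0 hneg

end ThmFiveFive

end Literature.NumberTheory.LFunctions
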